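import Summits.BirchSwinnertonDyer.BirchSwinnertonDyer.Theorems.AlignedTransportAtTwoMainConjectureOfRankZeroBSDAtTwoHalfDescentLayerIndexGrowthExact
import Summits.BirchSwinnertonDyer.BirchSwinnertonDyer.Theorems.AlignedTransportAtTwoMainConjectureOfRankZeroBSDAtTwoHalfDescentLayerIndexEventual
import Summits.BirchSwinnertonDyer.Rank1Residual.X1.LambdaSqueezeAlgebra
import HarnessLib

/-!
# Route `AlignedTransportAtTwo`, crux C2 `MainConjectureOfRankZeroBSDAtTwo` (stmt-BirchSwinnertonDyer-22298):
# THE GROWTH NUMBER WITHOUT GREENBERG 4.14, V — EVENTUALLY: for EVERY finitely generated torsion `Λ`-module `X` in a rank-`0` tower there is an EXPLICITLY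
# CONSTRUCTED `n₁` with `#(X/ω_{n+1}X) = p^{pⁿ(p−1)μ(X) + λ(X)} · #(X/ω_nX)` for all `n ≥ n₁` (Iwasawa's theorem with NO «no finite submodule» hypothesis); the
# descent number exceeds the growth number by EXACTLY `#(F/pF)`: `#(X/Ψ_nX) · #(X/ω_nX) = #(X/ω_{n+1}X) · #(F/pF)`; Selmer currency `#Sel_∞^{Γ_{n+1}} = p^{pⁿ(p−1)μ+λ}·#Sel_∞^{Γ_n}`

HONEST FRAMING (cell `bsd-f1-sign2`, WIDTH-5 attached prover seat `bsd-line-att-p5` gen 56 on line `birth` of the lead `bsd-line-att-p2`;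
`--supports` stmt-BirchSwinnertonDyer-22298, closes nothing; BSD is NOT proved by any of this; the crux C2, its verdict «blocked-on
`Rank1Residual.GreenbergMuConjectureIrreducible`» and every registered stub (P / T / Kμ / LimDoor / MuIneqʳ / PFμ⁺) are untouched). THEOREMS ONLY — no `def`,
no instance, no named fact, no `sorry`. Sequel of this gen's `…HalfDescentLayerIndexGrowthExact` (the exact one-step law past the finite submodule, for GIVEN `F`, `n`)
and gen 55's `…HalfDescentLayerIndexEventual` (a finite `Λ`-module is killed by `ω_n` for `n ≫ 0`; `#(X/Ψ_nX) = p^{pⁿ(p−1)μ+λ}·#(F/pF)` for `n ≫ 0`).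

THE POINT. `X` f.g. torsion, `char_Λ X = (f)`, rank-`0` tower (`f(0) ≠ 0`, `Ψ_m ∤ f` for all `m`); `F` = the largest finite submodule (tree: it exists and `X/F` has
none). Take `n₁ ≥ λ(f) + 1` (so `λ(f) < n₁ < p^{n₁} ≤ p^{n₁}(p−1)`) and `≥` the first layer killing `F`:
* §1 ★★★ `exists_forall_natCard_quotient_omega_succ_eq_pow_mul`: **`∃ n₁, ∀ n ≥ n₁, #(X/ω_{n+1}X) = p^{pⁿ(p−1)·μ(f) + λ(f)} · #(X/ω_nX)`** — and
  `…_eq_pow_invariants_mul` with the MODULE invariants `μ(X)`, `λ(X)` in the exponent (tree `mu_generator_eq_muInvariant`, `lam_generator_eq_lambdaInvariant`);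
  ★★★ `exists_forall_natCard_quotient_omega_mul_pow_eq`: **Iwasawa's `e_n = μpⁿ + λn + ν` for all `n ≥ n₁`** for EVERY f.g. torsion `X` in a rank-`0` tower.
* §2 ★★ `exists_forall_natCard_layerQuotient_mul_eq`: **`#(X/Ψ_nX) · #(X/ω_nX) = #(X/ω_{n+1}X) · #(F/pF)` for `n ≥ n₁`** — the DESCENT number of gens 54–55
  (`#(X/Ψ_nX) = #ker N_n`) is the GROWTH number times the constant `#(F/pF) = p^{dim_{𝔽_p} F/pF}`: the two one-layer currencies of the lineage differ EXACTLY by the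
  `p`-rank of the maximal finite submodule (`= 1` under Greenberg's Prop. 4.14–4.15).
* §3 Selmer currency (g40/g54 Pontryagin: `#(X/ω_nX) = #Sel_∞^{Γ_n}`, `#(X/Ψ_nX) = #ker N_n`): ★★★ `exists_forall_natCard_selmerInvariants_succ_eq_pow_mul` — for EVERY
  dual datum with `X` f.g. torsion in a rank-`0` tower, **`#Sel_{p^∞}(E/K_∞)^{Γ_{n+1}} = p^{pⁿ(p−1)μ + λ} · #Sel_{p^∞}(E/K_∞)^{Γ_n}` for all `n ≥ n₁`** (gen 54's
  `…LayerIndexSelmer.natCard_selmerInvariants_succ_eq_mul` needed `X` WITHOUT finite submodule); ★★ `exists_forall_natCard_endInvariants_mul_selmerInvariants_eq`: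
  **`#ker(N_n | Sel_∞) · #Sel_∞^{Γ_n} = #Sel_∞^{Γ_{n+1}} · #(F/pF)`** eventually.
Reading for C2 (`p = 2`): on the seed cell, under MC (`μ = 0`, `λ = λ_an`), the invariants of `Sel_{2^∞}(W/ℚ_∞)` eventually grow by EXACTLY `2^{λ_an}` per layer
whatever the finite part of `X(W/ℚ_∞)` is, while the relative-norm kernels stabilise at `2^{λ_an}·#(F/2F)`. What is NOT claimed: nothing about any curve; `n₁`
depends on the (unknown) finite submodule. Memo `Cruxes/MainConjectureOfRankZeroBSDAtTwo/LAYER-GROWTH-att-p5-g56.md`.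

References: K. Iwasawa, Bull. AMS 65 (1959); L. Washington, GTM 83, §13.3 Thm. 13.13 [Washington1997]; J. Neukirch, A. Schmidt, K. Wingberg, *Cohomology of Number
Fields*, (5.3.17) [NeukirchSchmidtWingberg2008]; R. Greenberg, LNM 1716 (1999), Thm. 1.10, §1 pp. 60–65, Prop. 4.14–4.15 [GreenbergLNM1716]; S. Lang, *Cyclotomic
Fields I–II*, Ch. 5 Thm. 1.2 [Lang1990].
-/

set_option linter.dupNamespace false
set_option autoImplicit false

noncomputable section

open scoped Classical AddSubgroup Polynomial

universe u

namespace Summit.BirchSwinnertonDyer.BirchSwinnertonDyer.Theorems.AlignedTransportAtTwoHalfDescentLayerIndexGrowthEventual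

open WeierstrassCurve Literature.NumberTheory.EllipticCurves Literature.NumberTheory.EllipticCurves.IwasawaDual
  Literature.NumberTheory.EllipticCurves.IwasawaAlgebra
  Summit.BirchSwinnertonDyer.Rank1Residual.X1.MuLambda
  Summit.BirchSwinnertonDyer.Rank1Residual.X1.ParitySqueeze
  Summit.BirchSwinnertonDyer.Rank1Residual.X1.GeneratorBoundMu
  Summit.BirchSwinnertonDyer.Rank1Residual.Iwasawa
  Summit.BirchSwinnertonDyer.BirchSwinnertonDyer.Theorems.DefectPrime
  Summit.BirchSwinnertonDyer.BirchSwinnertonDyer.Theorems.AlignedTransportAtTwoCyclotomicLayerPrime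
  Summit.BirchSwinnertonDyer.BirchSwinnertonDyer.Theorems.AlignedTransportAtTwoHalfDescentLayerIndex
  Summit.BirchSwinnertonDyer.BirchSwinnertonDyer.Theorems.AlignedTransportAtTwoHalfDescentLayerIndexFinite
  Summit.BirchSwinnertonDyer.BirchSwinnertonDyer.Theorems.AlignedTransportAtTwoHalfDescentLayerIndexSelmer
  Summit.BirchSwinnertonDyer.BirchSwinnertonDyer.Theorems.AlignedTransportAtTwoHalfDescentLayerIndexEventual
  Summit.BirchSwinnertonDyer.BirchSwinnertonDyer.Theorems.AlignedTransportAtTwoHalfDescentLayerIndexGrowthExact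

/-! ## §1 The exact law, eventually, for every finitely generated torsion module in a rank-`0` tower -/

section Module

variable {p : ℕ} [hp : Fact p.Prime] {M : Type u} [AddCommGroup M] [Module (IwasawaAlgebra p) M]

/-- With `F ≤ X` a finite submodule with `X/F` free of finite submodules: an explicit layer from which on the one-step law is exact. [cite: Washington1997, §13.3 Thm. 13.13] -/
theorem exists_forall_natCard_quotient_omega_succ_eq_pow_mul_of_submodule [Module.Finite (IwasawaAlgebra p) M] (hM : Module.IsTorsion (IwasawaAlgebra p) M)
    (F : Submodule (IwasawaAlgebra p) M) [Finite F] (hF : ∀ N' : Submodule (IwasawaAlgebra p) (M ⧸ F), Finite N' → N' = ⊥) {f : IwasawaAlgebra p}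
    (hchar : Literature.NumberTheory.EllipticCurves.Module.charIdeal (IwasawaAlgebra p) M = Ideal.span {f}) (h0 : PowerSeries.constantCoeff f ≠ 0)
    (hΨ : ∀ m, ¬ ((((Polynomial.cyclotomic (p ^ (m + 1)) ℤ_[p]).comp (Polynomial.X + 1) : ℤ_[p][X]) : IwasawaAlgebra p) ∣ f)) :
    ∃ n₁ : ℕ, lam f < p ^ n₁ * (p - 1) ∧ (∀ x ∈ F, (((1 + PowerSeries.X : PowerSeries ℤ_[p]) ^ (p ^ n₁) - 1 : IwasawaAlgebra p)) • x = 0) ∧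
      ∀ n, n₁ ≤ n →
        Nat.card (M ⧸ (Ideal.span {((1 + PowerSeries.X : PowerSeries ℤ_[p]) ^ (p ^ (n + 1)) - 1 : IwasawaAlgebra p)} • ⊤ : Submodule (IwasawaAlgebra p) M)) =
          p ^ (p ^ n * (p - 1) * mu f + lam f) *
            Nat.card (M ⧸ (Ideal.span {((1 + PowerSeries.X : PowerSeries ℤ_[p]) ^ (p ^ n) - 1 : IwasawaAlgebra p)} • ⊤ : Submodule (IwasawaAlgebra p) M)) := by
  obtain ⟨nF, hnF⟩ := exists_forall_omega_smul_eq_zero (p := p) (N := ↥F)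
  set n₁ := max nF (lam f + 1) with hn₁
  have hlam : ∀ n, n₁ ≤ n → lam f < p ^ n * (p - 1) := by
    intro n hn
    have h1 : n < p ^ n := Nat.lt_pow_self hp.out.one_lt
    have h2 : p ^ n ≤ p ^ n * (p - 1) := Nat.le_mul_of_pos_right _ (by have := hp.out.two_le; omega)
    have h3 : lam f + 1 ≤ n := (le_max_right _ _).trans hn
    omega
  have hFω : ∀ n, n₁ ≤ n → ∀ x ∈ F, (((1 + PowerSeries.X : PowerSeries ℤ_[p]) ^ (p ^ n) - 1 : IwasawaAlgebra p)) • x = 0 := by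
    intro n hn x hx
    have h := congrArg Subtype.val (hnF n ((le_max_left _ _).trans hn) ⟨x, hx⟩)
    simpa only [Submodule.coe_smul, Submodule.coe_zero] using h
  refine ⟨n₁, hlam n₁ le_rfl, hFω n₁ le_rfl, fun n hn ↦ ?_⟩
  exact natCard_quotient_omega_succ_eq_pow_mul hM F hF hchar h0 (fun m _ ↦ hΨ m) (hlam n hn) (hFω n hn)

/-- ★★★ **IWASAWA'S ONE-STEP LAW, EVENTUALLY EXACT, FOR EVERY FINITELY GENERATED TORSION `Λ`-MODULE IN A RANK-`0` TOWER** (`char_Λ X = (f)`, `f(0) ≠ 0`, `Ψ_m ∤ f` for all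
`m`; finite submodules ALLOWED): **`∃ n₁, ∀ n ≥ n₁, #(X/ω_{n+1}X) = p^{pⁿ(p−1)·μ(f) + λ(f)} · #(X/ω_nX)`**. NO «no finite submodule» hypothesis (gen 54 needed it); `n₁` is
explicit in the largest finite submodule (the first layer killing it, and `λ(f) + 1`). [cite: Washington1997, §13.3 Thm. 13.13] [cite: GreenbergLNM1716, Thm. 1.10] -/
theorem exists_forall_natCard_quotient_omega_succ_eq_pow_mul [Module.Finite (IwasawaAlgebra p) M] (hM : Module.IsTorsion (IwasawaAlgebra p) M)
    {f : IwasawaAlgebra p} (hchar : Literature.NumberTheory.EllipticCurves.Module.charIdeal (IwasawaAlgebra p) M = Ideal.span {f})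
    (h0 : PowerSeries.constantCoeff f ≠ 0) (hΨ : ∀ m, ¬ ((((Polynomial.cyclotomic (p ^ (m + 1)) ℤ_[p]).comp (Polynomial.X + 1) : ℤ_[p][X]) : IwasawaAlgebra p) ∣ f)) :
    ∃ n₁ : ℕ, ∀ n, n₁ ≤ n →
      Nat.card (M ⧸ (Ideal.span {((1 + PowerSeries.X : PowerSeries ℤ_[p]) ^ (p ^ (n + 1)) - 1 : IwasawaAlgebra p)} • ⊤ : Submodule (IwasawaAlgebra p) M)) =
        p ^ (p ^ n * (p - 1) * mu f + lam f) *
          Nat.card (M ⧸ (Ideal.span {((1 + PowerSeries.X : PowerSeries ℤ_[p]) ^ (p ^ n) - 1 : IwasawaAlgebra p)} • ⊤ : Submodule (IwasawaAlgebra p) M)) := by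
  haveI : IsNoetherian (IwasawaAlgebra p) M := inferInstance
  obtain ⟨F, hFfin, hFmax⟩ := exists_finite_submodule_forall_finite_le (R := IwasawaAlgebra p) (M := M)
  haveI : Finite F := hFfin
  obtain ⟨n₁, -, -, h⟩ := exists_forall_natCard_quotient_omega_succ_eq_pow_mul_of_submodule hM F (forall_finite_eq_bot_quotient_of_forall_finite_le F hFmax) hchar h0 hΨ
  exact ⟨n₁, h⟩

/-- ★★★ **The same with the invariants OF THE MODULE: `∃ n₁, ∀ n ≥ n₁, #(X/ω_{n+1}X) = p^{pⁿ(p−1)·μ(X) + λ(X)} · #(X/ω_nX)`** (`μ(X) = μ(f)`, `λ(X) = λ(f)` for any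
generator `f` of `char_Λ X`, tree). [cite: Washington1997, §13.2–13.3] [cite: GreenbergLNM1716, Thm. 1.10] -/
theorem exists_forall_natCard_quotient_omega_succ_eq_pow_invariants_mul [Module.Finite (IwasawaAlgebra p) M] (hM : Module.IsTorsion (IwasawaAlgebra p) M)
    {f : IwasawaAlgebra p} (hchar : Literature.NumberTheory.EllipticCurves.Module.charIdeal (IwasawaAlgebra p) M = Ideal.span {f})
    (h0 : PowerSeries.constantCoeff f ≠ 0) (hΨ : ∀ m, ¬ ((((Polynomial.cyclotomic (p ^ (m + 1)) ℤ_[p]).comp (Polynomial.X + 1) : ℤ_[p][X]) : IwasawaAlgebra p) ∣ f)) :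
    ∃ n₁ : ℕ, ∀ n, n₁ ≤ n →
      Nat.card (M ⧸ (Ideal.span {((1 + PowerSeries.X : PowerSeries ℤ_[p]) ^ (p ^ (n + 1)) - 1 : IwasawaAlgebra p)} • ⊤ : Submodule (IwasawaAlgebra p) M)) =
        p ^ (p ^ n * (p - 1) * muInvariant p M + lambdaInvariant p M) *
          Nat.card (M ⧸ (Ideal.span {((1 + PowerSeries.X : PowerSeries ℤ_[p]) ^ (p ^ n) - 1 : IwasawaAlgebra p)} • ⊤ : Submodule (IwasawaAlgebra p) M)) := by
  have hf0 : f ≠ 0 := fun h ↦ h0 (by rw [h, map_zero])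
  rw [← Summit.BirchSwinnertonDyer.Rank1Residual.X1.MuPart.mu_generator_eq_muInvariant M hM hf0 hchar, ← lam_generator_eq_lambdaInvariant M hM hf0 hchar]
  exact exists_forall_natCard_quotient_omega_succ_eq_pow_mul hM hchar h0 hΨ

/-- ★★★ **IWASAWA'S THEOREM `e_n = μpⁿ + λn + ν` (`n ≥ n₁`) FOR EVERY FINITELY GENERATED TORSION `Λ`-MODULE IN A RANK-`0` TOWER**, finite submodule allowed:
`∃ n₁, ∀ n ≥ n₁, #(X/ω_nX) · p^{μ(f)p^{n₁} + λ(f)n₁} = #(X/ω_{n₁}X) · p^{μ(f)pⁿ + λ(f)n}`. [cite: Washington1997, §13.3 Thm. 13.13] [cite: Lang1990, Ch. 5 Thm. 1.2]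
[cite: GreenbergLNM1716, Thm. 1.10] -/
theorem exists_forall_natCard_quotient_omega_mul_pow_eq [Module.Finite (IwasawaAlgebra p) M] (hM : Module.IsTorsion (IwasawaAlgebra p) M)
    {f : IwasawaAlgebra p} (hchar : Literature.NumberTheory.EllipticCurves.Module.charIdeal (IwasawaAlgebra p) M = Ideal.span {f})
    (h0 : PowerSeries.constantCoeff f ≠ 0) (hΨ : ∀ m, ¬ ((((Polynomial.cyclotomic (p ^ (m + 1)) ℤ_[p]).comp (Polynomial.X + 1) : ℤ_[p][X]) : IwasawaAlgebra p) ∣ f)) :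
    ∃ n₁ : ℕ, ∀ n, n₁ ≤ n →
      Nat.card (M ⧸ (Ideal.span {((1 + PowerSeries.X : PowerSeries ℤ_[p]) ^ (p ^ n) - 1 : IwasawaAlgebra p)} • ⊤ : Submodule (IwasawaAlgebra p) M)) *
          p ^ (mu f * p ^ n₁ + lam f * n₁) =
        Nat.card (M ⧸ (Ideal.span {((1 + PowerSeries.X : PowerSeries ℤ_[p]) ^ (p ^ n₁) - 1 : IwasawaAlgebra p)} • ⊤ : Submodule (IwasawaAlgebra p) M)) *
          p ^ (mu f * p ^ n + lam f * n) := by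
  haveI : IsNoetherian (IwasawaAlgebra p) M := inferInstance
  obtain ⟨F, hFfin, hFmax⟩ := exists_finite_submodule_forall_finite_le (R := IwasawaAlgebra p) (M := M)
  haveI : Finite F := hFfin
  have hF := forall_finite_eq_bot_quotient_of_forall_finite_le F hFmax
  obtain ⟨n₁, hlam, hFω, -⟩ := exists_forall_natCard_quotient_omega_succ_eq_pow_mul_of_submodule hM F hF hchar h0 hΨ
  exact ⟨n₁, fun n hn ↦ natCard_quotient_omega_mul_pow_eq' hM F hF hchar h0 (fun m _ ↦ hΨ m) hlam hFω hn⟩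

/-! ## §2 The descent number is the growth number times `#(F/pF)` -/

/-- ★★ **`#(X/Ψ_nX) · #(X/ω_nX) = #(X/ω_{n+1}X) · #(F/pF)` for all `n ≥ n₁`** (`X` ANY f.g. torsion in a rank-`0` tower, `F ≤ X` finite with `X/F` free of finite
submodules): the DESCENT number `#(X/Ψ_nX)` (`= #ker N_n`, gens 54–55) is the GROWTH number `#(X/ω_{n+1}X)/#(X/ω_nX)` times the constant `#(F/pF) = p^{dim_{𝔽_p} F/pF}`.
[cite: Washington1997, §13.3 Thm. 13.13] [cite: NeukirchSchmidtWingberg2008, (5.3.17)] [cite: GreenbergLNM1716, Prop. 4.14–4.15] -/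
theorem exists_forall_natCard_layerQuotient_mul_eq [Module.Finite (IwasawaAlgebra p) M] (hM : Module.IsTorsion (IwasawaAlgebra p) M)
    (F : Submodule (IwasawaAlgebra p) M) [Finite F] (hF : ∀ N' : Submodule (IwasawaAlgebra p) (M ⧸ F), Finite N' → N' = ⊥) {f : IwasawaAlgebra p}
    (hchar : Literature.NumberTheory.EllipticCurves.Module.charIdeal (IwasawaAlgebra p) M = Ideal.span {f}) (h0 : PowerSeries.constantCoeff f ≠ 0)
    (hΨ : ∀ m, ¬ ((((Polynomial.cyclotomic (p ^ (m + 1)) ℤ_[p]).comp (Polynomial.X + 1) : ℤ_[p][X]) : IwasawaAlgebra p) ∣ f)) :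
    ∃ n₁ : ℕ, ∀ n, n₁ ≤ n →
      Nat.card (M ⧸ (Ideal.span {(((Polynomial.cyclotomic (p ^ (n + 1)) ℤ_[p]).comp (Polynomial.X + 1) : ℤ_[p][X]) : IwasawaAlgebra p)} • ⊤ :
          Submodule (IwasawaAlgebra p) M)) *
        Nat.card (M ⧸ (Ideal.span {((1 + PowerSeries.X : PowerSeries ℤ_[p]) ^ (p ^ n) - 1 : IwasawaAlgebra p)} • ⊤ : Submodule (IwasawaAlgebra p) M)) =
      Nat.card (M ⧸ (Ideal.span {((1 + PowerSeries.X : PowerSeries ℤ_[p]) ^ (p ^ (n + 1)) - 1 : IwasawaAlgebra p)} • ⊤ : Submodule (IwasawaAlgebra p) M)) *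
        Nat.card (F ⧸ (Ideal.span {(PowerSeries.C (p : ℤ_[p]) : IwasawaAlgebra p)} • ⊤ : Submodule (IwasawaAlgebra p) F)) := by
  obtain ⟨n₁, -, -, h₁⟩ := exists_forall_natCard_quotient_omega_succ_eq_pow_mul_of_submodule hM F hF hchar h0 hΨ
  obtain ⟨n₂, h₂⟩ := exists_forall_natCard_layerQuotient_eq_pow_mul_natCard_quotient_p hM F hF hchar
  refine ⟨max n₁ n₂, fun n hn ↦ ?_⟩
  rw [h₁ n ((le_max_left _ _).trans hn), h₂ n ((le_max_right _ _).trans hn)]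
  ring

end Module

/-! ## §3 Selmer currency -/

section Selmer

variable {K : Type u} [Field K] [NumberField K] (W : WeierstrassCurve K) {p : ℕ} [hp : Fact p.Prime] (κ : ZpExtension K p)
  {γ : Field.absoluteGaloisGroup K}

/-- ★★★ **IWASAWA'S THEOREM FOR `Sel_{p^∞}(E/K_∞)^{Γ_n}` WITHOUT PROP. 4.14.** `E/K`, `κ` any `ℤ_p`-extension with topological generator `γ`, `D` any Pontryagin-dual datum with
`X` finitely generated torsion, `char_Λ X = (f)`, `f(0) ≠ 0` and `Ψ_m ∤ f` for all `m` (the rank-`0` tower). Then there is `n₁` with, for every `n ≥ n₁`: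
**`#Sel_∞^{Γ_{n+1}} = p^{pⁿ(p−1)·μ(X) + λ(X)} · #Sel_∞^{Γ_n}`** and **`#Sel_∞^{Γ_n} · p^{μp^{n₁} + λn₁} = #Sel_∞^{Γ_{n₁}} · p^{μpⁿ + λn}`** — whatever the maximal finite submodule of
`X(E/K_∞)` is (gen 54's `…LayerIndexSelmer.natCard_selmerInvariants_mul_pow_eq` required `X` to have none). [cite: GreenbergLNM1716, Thm. 1.10 and §3 p. 85]
[cite: Washington1997, §13.3 Thm. 13.13] -/
theorem exists_forall_natCard_selmerInvariants_succ_eq_pow_mul (hγ : κ.IsTopGenerator γ) (D : W.SelmerDualData κ γ) [Module.Finite (IwasawaAlgebra p) D.X]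
    (hD : D.IsTorsion) {f : IwasawaAlgebra p} (hchar : D.charIdeal = Ideal.span {f}) (h0 : PowerSeries.constantCoeff f ≠ 0)
    (hΨ : ∀ m, ¬ ((((Polynomial.cyclotomic (p ^ (m + 1)) ℤ_[p]).comp (Polynomial.X + 1) : ℤ_[p][X]) : IwasawaAlgebra p) ∣ f)) :
    ∃ n₁ : ℕ, ∀ n, n₁ ≤ n →
      Nat.card ↥(W.selmerInfty κ ⊓ W.layerInvariants κ (n + 1)) = p ^ (p ^ n * (p - 1) * D.mu + D.lambda) * Nat.card ↥(W.selmerInfty κ ⊓ W.layerInvariants κ n) ∧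
      Nat.card ↥(W.selmerInfty κ ⊓ W.layerInvariants κ n) * p ^ (D.mu * p ^ n₁ + D.lambda * n₁) =
        Nat.card ↥(W.selmerInfty κ ⊓ W.layerInvariants κ n₁) * p ^ (D.mu * p ^ n + D.lambda * n) := by
  have hf0 : f ≠ 0 := fun h ↦ h0 (by rw [h, map_zero])
  have hμ : D.mu = mu f := (Summit.BirchSwinnertonDyer.Rank1Residual.X1.MuPart.mu_generator_eq_muInvariant D.X hD hf0 hchar).symm
  have hl : D.lambda = lam f := (lam_generator_eq_lambdaInvariant D.X hD hf0 hchar).symm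
  haveI : IsNoetherian (IwasawaAlgebra p) D.X := inferInstance
  obtain ⟨F, hFfin, hFmax⟩ := exists_finite_submodule_forall_finite_le (R := IwasawaAlgebra p) (M := D.X)
  haveI : Finite F := hFfin
  have hF := forall_finite_eq_bot_quotient_of_forall_finite_le F hFmax
  obtain ⟨n₁, hlam, hFω, hstep⟩ := exists_forall_natCard_quotient_omega_succ_eq_pow_mul_of_submodule (M := D.X) hD F hF hchar h0 hΨ
  refine ⟨n₁, fun n hn ↦ ⟨?_, ?_⟩⟩
  · rw [← natCard_layerQuotient_omega_eq_natCard_selmerInvariants W κ hγ D (n + 1), ← natCard_layerQuotient_omega_eq_natCard_selmerInvariants W κ hγ D n, hμ, hl]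
    exact hstep n hn
  · rw [← natCard_layerQuotient_omega_eq_natCard_selmerInvariants W κ hγ D n, ← natCard_layerQuotient_omega_eq_natCard_selmerInvariants W κ hγ D n₁, hμ, hl]
    exact natCard_quotient_omega_mul_pow_eq' (M := D.X) hD F hF hchar h0 (fun m _ ↦ hΨ m) hlam hFω hn

/-- ★★ **THE RELATIVE-NORM KERNEL IS THE INVARIANT GROWTH TIMES `#(F/pF)`, EVENTUALLY**: same setting, `F ≤ X` finite with `X/F` free of finite submodules; there is
`n₁` with **`#ker(N_n | Sel_{p^∞}(E/K_∞)) · #Sel_∞^{Γ_n} = #Sel_∞^{Γ_{n+1}} · #(F/pF)` for all `n ≥ n₁`** (`N_n = ∑_{i<p}(conj_γ^{pⁿ})^i`). The two one-layer currencies of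
the lineage (gens 54–55: `#ker N_n`; this gen: the growth `#Sel_∞^{Γ_{n+1}}/#Sel_∞^{Γ_n}`) differ EXACTLY by the `p`-rank of the maximal finite submodule of `X(E/K_∞)`.
[cite: GreenbergLNM1716, §1 pp. 60–65 and Prop. 4.14–4.15] [cite: Washington1997, §13.3 Thm. 13.13] -/
theorem exists_forall_natCard_endInvariants_mul_selmerInvariants_eq (hγ : κ.IsTopGenerator γ) (D : W.SelmerDualData κ γ)
    [Module.Finite (IwasawaAlgebra p) D.X] (hD : D.IsTorsion) (F : Submodule (IwasawaAlgebra p) D.X) [Finite F]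
    (hF : ∀ N' : Submodule (IwasawaAlgebra p) (D.X ⧸ F), Finite N' → N' = ⊥) {f : IwasawaAlgebra p} (hchar : D.charIdeal = Ideal.span {f})
    (h0 : PowerSeries.constantCoeff f ≠ 0) (hΨ : ∀ m, ¬ ((((Polynomial.cyclotomic (p ^ (m + 1)) ℤ_[p]).comp (Polynomial.X + 1) : ℤ_[p][X]) : IwasawaAlgebra p) ∣ f)) :
    ∃ n₁ : ℕ, ∀ n, n₁ ≤ n →
      Nat.card ↥(endInvariants (∑ i ∈ Finset.range p, ((W.conjSelmerInfty κ γ) ^ (p ^ n)) ^ i)) * Nat.card ↥(W.selmerInfty κ ⊓ W.layerInvariants κ n) =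
        Nat.card ↥(W.selmerInfty κ ⊓ W.layerInvariants κ (n + 1)) *
          Nat.card (F ⧸ (Ideal.span {(PowerSeries.C (p : ℤ_[p]) : IwasawaAlgebra p)} • ⊤ : Submodule (IwasawaAlgebra p) F)) := by
  obtain ⟨n₁, h⟩ := exists_forall_natCard_layerQuotient_mul_eq (M := D.X) hD F hF hchar h0 hΨ
  refine ⟨n₁, fun n hn ↦ ?_⟩
  rw [← natCard_layerQuotient_cyclotomic_eq_natCard_endInvariants W κ hγ D n, ← natCard_layerQuotient_omega_eq_natCard_selmerInvariants W κ hγ D n,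
    ← natCard_layerQuotient_omega_eq_natCard_selmerInvariants W κ hγ D (n + 1)]
  exact h n hn

end Selmer

end Summit.BirchSwinnertonDyer.BirchSwinnertonDyer.Theorems.AlignedTransportAtTwoHalfDescentLayerIndexGrowthEventual

end
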